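/-
Copyright (c) 2026 the pub-hodgecm-mathlib formalisation cell (harness21).  Prover seat hodgecm-mathlib-LH4-p06 (g3): Track A «(D-RAM) FOUR-FRAME» squad of crux H413, unit
U3_Laws, (KMS) road «MODULO κ-STAGE B», brick κB-H «CORE-HANGING κ-SOCKETS» FILE (A1) (dealer LH4-plan (g11) WORD #34), 2026-09-04.
-/
import Summits.HodgeConjecture.HodgeConjecture.Theorems.F0P3cDyRamDiagonalCoreHangingCriterion   -- ★ p855897 (LH4-p07 (g3)) B7 (i): the type-0 polarisation of a core-hanging lattice (its PROOF is re-run here with the form EXPOSED); brings ★ B5 (i) Gram tools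
import Summits.HodgeConjecture.HodgeConjecture.Theorems.F0P3cDyRamDiagonalKappaCountEval        -- ★ (LH4-p05 (g3)) Fκ2: `chiVec`, `normSign` tools
import Literature.NumberTheory.Automorphic.UnitaryThreeFourFrameFamilyExists                     -- ★ `normSign_of_isNorm`, `normSign_inv_of_map_eq` (the sign `ω = normSign σ`)
import HarnessLib

/-!
# Crux `H413`, (KMS) ROAD «MODULO κ-STAGE B», brick κB-H FILE (A1): THE EXPLICIT TYPE-0 POLARISATION OF A CORE-HANGING LATTICE AND ITS ω-TABLE

Cell `hodgecm-mathlib` (D-0151), FLOOR 0, crux item H413 = `stmt-HodgeConjecture-24833`; lane `--supports stmt-HodgeConjecture-24833 --as helper` (count-neutral).  THEOREMS ONLY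
(no `def`, no instance, no notation, no `sorry`, default heartbeats).  Input: ★ p07 (g3) B7 (i) `isDualisableLattice_latt_hnf_coreHanging_of` — the dualisability criterion of
`latt (1 0 0; x ϖ^ρ 0; xζ+y″ ϖ^ρζ ϖ^{2ρ})`, whose proof CONSTRUCTS the polarising form; §1 re-runs that proof verbatim with the form recorded in the statement (so that its
ω-classes can be read), §2 reads them at the exact invariant `y″ = f·xζ`, lineariser `f′ = f·ζσζ`: `(ω(D₀), ω(D₁), ω(D₂)) = (ω(f), 1, ω(−(1+f)))` (LH4-p06 (g3) head letter
da173de2 (F2)).  FILE (A2) `F0P3cDyRamDiagonalKappaCoreHangingClass` turns this into the κ-count of the lattice.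
HONEST LABEL.  Count-neutral; `HC_CM` is proved only modulo the 7 printed citations (2 remaining named inputs: hLiu418 = `stmt-HodgeConjecture-24832`, h413 = `stmt-HodgeConjecture-24833`)
until rung 0 closes.

## References
* [Kottwitz1986BaseChangeUnits] R. Kottwitz, *Base change for unit elements of Hecke algebras*, Compositio Math. 60 (1986), §1 pp. 240–241 (κ-orbital integrals as signed lattice counts).
* [Rogawski1990] J. D. Rogawski, *Automorphic Representations of Unitary Groups in Three Variables*, Ann. of Math. Stud. 123 (1990), §4.9 Prop. 4.9.1 (a) p. 55; §4.10 p. 58.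
* [Jacobowitz1962] R. Jacobowitz, *Hermitian forms over local fields*, Amer. J. Math. 84 (1962), §7 (unimodular lattices, dual bases).
-/

set_option autoImplicit false

noncomputable section

namespace Summit.HodgeConjecture.HodgeConjecture.Cruxes.H413.F0P3cDyRamDiagonalCoreHangingPolarisationExplicit

open Matrix WithZero
open Literature.NumberTheory.Automorphic Literature.NumberTheory.Automorphic.HermitianLattice Literature.NumberTheory.Automorphic.UnitaryGroup
open Literature.NumberTheory.Automorphic.UnitaryLatticeTree Literature.NumberTheory.Automorphic.UnitaryThreeFourFrame
open Summit.HodgeConjecture.HodgeConjecture.Cruxes.H413.F0P3cDyRamDiagonalTorusDefs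
open Summit.HodgeConjecture.HodgeConjecture.Cruxes.H413.F0P3cDyRamDiagonalGluedTubeCriterion
open Summit.HodgeConjecture.HodgeConjecture.Cruxes.H413.F0P3cDyRamDiagonalCoreHangingCriterion
open Summit.HodgeConjecture.HodgeConjecture.Cruxes.H413.F0P3cDyRamDiagonalKappaCountDefs
open Summit.HodgeConjecture.HodgeConjecture.Cruxes.H413.F0P3cDyRamDiagonalKappaCountEval
open scoped Valued WithZero Matrix MatrixGroups

variable {K : Type} [Field K] [Valued K ℤᵐ⁰]

/-! ## §1 The explicit type-0 polarisation of a core-hanging lattice (★ B7 (i)'s construction, form exposed) -/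

/-- **THE EXPLICIT POLARISATION** of `latt (1 0 0; x ϖ^ρ 0; xζ+y″ ϖ^ρζ ϖ^{2ρ})` (`x, ζ, y″, xζ + y″` units, `ρ ≥ 1`, criterion (R) with a fixed lineariser `f`): the lattice is a
type-0 vertex of `diag(D)` with `D₁ = (ϖσϖ)^{−ρ}`, `D₂ = −(ζσζ + f)⁻¹·D₁`, `D₀ = −(D₁·σx·x + D₂·σy·y)`, `y = xζ + y″` — ★ B7 (i) `isDualisableLattice_latt_hnf_coreHanging_of`'s proof,
verbatim, with the form it builds recorded in the statement (so that its ω-classes can be read). [cite: Jacobowitz1962, §7] [cite: Kottwitz1986BaseChangeUnits, §1 pp. 240–241] -/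
theorem exists_explicit_polarisation_latt_hnf_coreHanging {σ : K →+* K} (hσ : ∀ a, σ (σ a) = a) (hvσ : ∀ a, Valued.v (σ a) = Valued.v a)
    {ϖ : K} (hϖ0 : ϖ ≠ 0) (hϖ1 : Valued.v ϖ < 1) (hTr : ∀ a : K, Valued.v (a + σ a) ≤ Valued.v ϖ * Valued.v a)
    (ρ : ℕ) (hρ : 1 ≤ ρ) {x ζ y'' : K} (hx : Valued.v x = 1) (hζ : Valued.v ζ = 1) (hy'' : Valued.v y'' = 1) (hy : Valued.v (x * ζ + y'') = 1)
    (V : GL (Fin 3) K) (hV : (V : Matrix (Fin 3) (Fin 3) K) = !![1, 0, 0; x, ϖ ^ ρ, 0; x * ζ + y'', ϖ ^ ρ * ζ, ϖ ^ (2 * ρ)])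
    {f : K} (hf : σ f = f) (hR : Valued.v (ζ * σ y'' - σ x * f) ≤ Valued.v ϖ ^ ρ) :
    ∃ D : Fin 3 → K, (D 1 = ((ϖ * σ ϖ) ^ ρ)⁻¹ ∧ D 2 = -(ζ * σ ζ + f)⁻¹ * ((ϖ * σ ϖ) ^ ρ)⁻¹ ∧
        D 0 = -(((ϖ * σ ϖ) ^ ρ)⁻¹ * (σ x * x) + -(ζ * σ ζ + f)⁻¹ * ((ϖ * σ ϖ) ^ ρ)⁻¹ * (σ (x * ζ + y'') * (x * ζ + y'')))) ∧
      (∀ i, σ (D i) = D i ∧ D i ≠ 0) ∧ IsVertexLattice σ ϖ (Matrix.diagonal D) 0 (latt (V : Matrix (Fin 3) (Fin 3) K)) := by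
  set c : ℕ := 2 * ρ with hc
  have hvϖ : 0 < Valued.v ϖ := (Valuation.pos_iff _).2 hϖ0
  have hϖ1' : Valued.v ϖ ≤ 1 := hϖ1.le
  have hvϖc : Valued.v ϖ ^ c ≠ 0 := pow_ne_zero _ hvϖ.ne'
  have hϖρ1 : Valued.v ϖ ^ ρ < 1 := pow_lt_one₀ zero_le hϖ1 (by omega)
  have h2 : Valued.v (2 : K) < 1 := (v_two_le_of_trace_bound hTr).trans_lt hϖ1
  -- `|f| = 1`
  have h1 : Valued.v (ζ * σ y'') = 1 := by rw [map_mul, hζ, hvσ, hy'', one_mul]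
  have hRlt : Valued.v (ζ * σ y'' - σ x * f) < 1 := hR.trans_lt hϖρ1
  have hvxf : Valued.v (σ x * f) = 1 := by
    have e : σ x * f = ζ * σ y'' + -(ζ * σ y'' - σ x * f) := by ring
    rw [e, Valuation.map_add_eq_of_lt_left _ (by rwa [Valuation.map_neg, h1]), h1]
  have hvf : Valued.v f = 1 := by rw [map_mul, hvσ, hx, one_mul] at hvxf; exact hvxf
  -- the unit `Nζ + f` (uses `|y| = 1`) and `w`
  set y : K := x * ζ + y'' with hydef
  set Nζ : K := ζ * σ ζ with hNζ
  have hvNζ : Valued.v Nζ = 1 := by rw [hNζ, map_mul, hvσ, hζ, one_mul]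
  have hkey : σ x * (Nζ + f) = ζ * σ y + -(ζ * σ y'' - σ x * f) := by
    rw [hydef, hNζ, map_add, map_mul]; ring
  have hvζσy : Valued.v (ζ * σ y) = 1 := by rw [map_mul, hζ, hvσ, hy, one_mul]
  have hvNf : Valued.v (Nζ + f) = 1 := by
    have h' : Valued.v (σ x * (Nζ + f)) = 1 := by
      rw [hkey, Valuation.map_add_eq_of_lt_left _ (by rwa [Valuation.map_neg, hvζσy]), hvζσy]
    rw [map_mul, hvσ, hx, one_mul] at h'; exact h'
  have hNf0 : Nζ + f ≠ 0 := fun h => by rw [h, map_zero] at hvNf; exact zero_ne_one hvNf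
  set w : K := -(Nζ + f)⁻¹ with hw
  have hσNζ : σ Nζ = Nζ := by rw [hNζ, map_mul, hσ, mul_comm]
  have hσw : σ w = w := by rw [hw, map_neg, map_inv₀, map_add, hσNζ, hf]
  have hvw : Valued.v w = 1 := by rw [hw, Valuation.map_neg, map_inv₀, hvNf, inv_one]
  have hw0 : w ≠ 0 := fun h => by rw [h, map_zero] at hvw; exact zero_ne_one hvw
  have hε : 1 + w * Nζ = -(w * f) := by rw [hw]; field_simp; ring
  -- the uniformiser of `F` and the form
  set π₀ : K := ϖ * σ ϖ with hπ₀
  have hσπ₀ : σ π₀ = π₀ := by rw [hπ₀, map_mul, hσ, mul_comm]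
  have hvπ₀ : Valued.v π₀ = Valued.v ϖ ^ 2 := by rw [hπ₀, map_mul, hvσ, sq]
  have hσϖ0 : σ ϖ ≠ 0 := fun h => hϖ0 (by rw [← hσ ϖ, h, map_zero])
  have hπ₀0 : π₀ ≠ 0 := mul_ne_zero hϖ0 hσϖ0
  set D₁ : K := (π₀ ^ ρ)⁻¹ with hD₁
  set D₂ : K := w * D₁ with hD₂
  set D₀ : K := -(D₁ * (σ x * x) + D₂ * (σ y * y)) with hD₀
  have hvD₁ : Valued.v D₁ = (Valued.v ϖ ^ c)⁻¹ := by
    rw [hD₁, map_inv₀, map_pow, hvπ₀, ← pow_mul, hc]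
  have hvD₂ : Valued.v D₂ = (Valued.v ϖ ^ c)⁻¹ := by rw [hD₂, map_mul, hvw, one_mul, hvD₁]
  have hD₁0 : D₁ ≠ 0 := by rw [hD₁]; exact inv_ne_zero (pow_ne_zero _ hπ₀0)
  have hD₂0 : D₂ ≠ 0 := mul_ne_zero hw0 hD₁0
  have hσD₁ : σ D₁ = D₁ := by rw [hD₁, map_inv₀, map_pow, hσπ₀]
  have hσD₂ : σ D₂ = D₂ := by rw [hD₂, map_mul, hσw, hσD₁]
  have hσD₀ : σ D₀ = D₀ := by
    rw [hD₀]; simp only [map_neg, map_add, map_mul, hσ, hσD₁, hσD₂]; ring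
  have hvy : Valued.v y ≤ 1 := hy.le
  -- (k1) the glued entry: `D₁σx + D₂ζσy = D₁·w·(ζσy″ − σx·f)`
  have hk1 : D₁ * σ x + D₂ * ζ * σ y = D₁ * w * (ζ * σ y'' - σ x * f) := by
    have e1 : D₁ * σ x + D₂ * ζ * σ y = D₁ * (σ x * (1 + w * Nζ) + w * ζ * σ y'') := by
      rw [hD₂, hydef, map_add, map_mul, hNζ]; ring
    rw [e1, hε]; ring
  have hvk1 : Valued.v (D₁ * σ x + D₂ * ζ * σ y) * Valued.v ϖ ^ ρ ≤ 1 := by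
    rw [hk1, map_mul, map_mul, hvD₁, hvw, mul_one]
    have hAB : Valued.v (ζ * σ y'' - σ x * f) * Valued.v ϖ ^ ρ ≤ Valued.v ϖ ^ c :=
      calc Valued.v (ζ * σ y'' - σ x * f) * Valued.v ϖ ^ ρ ≤ Valued.v ϖ ^ ρ * Valued.v ϖ ^ ρ := mul_le_mul_left hR _
        _ = Valued.v ϖ ^ c := by rw [← pow_add, hc]; congr 1; ring
    calc (Valued.v ϖ ^ c)⁻¹ * Valued.v (ζ * σ y'' - σ x * f) * Valued.v ϖ ^ ρ
        = (Valued.v ϖ ^ c)⁻¹ * (Valued.v (ζ * σ y'' - σ x * f) * Valued.v ϖ ^ ρ) := mul_assoc _ _ _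
      _ ≤ (Valued.v ϖ ^ c)⁻¹ * Valued.v ϖ ^ c := mul_le_mul_right hAB _
      _ = 1 := inv_mul_cancel₀ hvϖc
  -- (k2) the second diagonal entry: `σ(ϖ^ρ)D₁ϖ^ρ + σ(ϖ^ρζ)D₂ϖ^ρζ = π₀^ρ·D₁·(1 + wNζ) = −π₀^ρ D₁ w f`, a unit
  have hk2 : σ (ϖ ^ ρ) * D₁ * ϖ ^ ρ + σ (ϖ ^ ρ * ζ) * D₂ * (ϖ ^ ρ * ζ) = -(π₀ ^ ρ * D₁ * w * f) := by
    have e : σ (ϖ ^ ρ) * D₁ * ϖ ^ ρ + σ (ϖ ^ ρ * ζ) * D₂ * (ϖ ^ ρ * ζ) = π₀ ^ ρ * D₁ * (1 + w * Nζ) := by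
      rw [hD₂, hNζ, hπ₀, map_mul, map_pow, mul_pow]; ring
    rw [e, hε]; ring
  have hvk2 : Valued.v (σ (ϖ ^ ρ) * D₁ * ϖ ^ ρ + σ (ϖ ^ ρ * ζ) * D₂ * (ϖ ^ ρ * ζ)) ≤ 1 := by
    rw [hk2, Valuation.map_neg, map_mul Valued.v (π₀ ^ ρ * D₁ * w) f, map_mul Valued.v (π₀ ^ ρ * D₁) w, map_mul Valued.v (π₀ ^ ρ) D₁, map_pow, hvπ₀, hvD₁, hvw,
      hvf, mul_one, mul_one, ← pow_mul, ← hc, mul_inv_cancel₀ hvϖc]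
  -- (k4) `|Nx + wNy| = 1`, whence `|D₀| = |ϖ|^{−2ρ}`
  have hk4 : σ x * x + w * (σ y * y) = w * (-(f * (σ x * x)) + σ y'' * y'') + w * (σ (x * ζ) * y'' + σ (σ (x * ζ) * y'')) := by
    have e : σ y * y = (σ x * x) * Nζ + (σ (x * ζ) * y'' + σ (σ (x * ζ) * y'')) + σ y'' * y'' := by
      rw [hydef, hNζ]; simp only [map_add, map_mul, hσ]; ring
    rw [e, show σ x * x + w * (σ x * x * Nζ + (σ (x * ζ) * y'' + σ (σ (x * ζ) * y'')) + σ y'' * y'') =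
      (1 + w * Nζ) * (σ x * x) + w * (σ y'' * y'') + w * (σ (x * ζ) * y'' + σ (σ (x * ζ) * y'')) by ring, hε]
    ring
  -- the main term `−f·Nx + Ny″ = σy″·(y − 2xζ) − x·(σx·f − ζσy″)` is a unit
  have hvmain : Valued.v (-(f * (σ x * x)) + σ y'' * y'') = 1 := by
    have e : -(f * (σ x * x)) + σ y'' * y'' = σ y'' * (y - 2 * (x * ζ)) + x * (ζ * σ y'' - σ x * f) := by rw [hydef]; ring
    have hu : Valued.v (σ y'' * (y - 2 * (x * ζ))) = 1 := by
      rw [map_mul, hvσ, hy'', one_mul, sub_eq_add_neg,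
        Valuation.map_add_eq_of_lt_left _ (by rw [Valuation.map_neg, map_mul, map_mul, hx, hζ, mul_one, mul_one, hy]; exact h2), hy]
    have hsmall : Valued.v (x * (ζ * σ y'' - σ x * f)) < Valued.v (σ y'' * (y - 2 * (x * ζ))) := by
      rw [hu, map_mul, hx, one_mul]; exact hRlt
    rw [e, v_add_eq_of_lt hsmall, hu]
  have hvrest : Valued.v (w * (σ (x * ζ) * y'' + σ (σ (x * ζ) * y''))) < 1 := by
    rw [map_mul, hvw, one_mul]
    refine (hTr _).trans_lt ?_
    rw [map_mul, hvσ, map_mul, hx, hζ, one_mul, one_mul, hy'', mul_one]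
    exact hϖ1
  have hvk4 : Valued.v (σ x * x + w * (σ y * y)) = 1 := by
    have hm : Valued.v (w * (-(f * (σ x * x)) + σ y'' * y'')) = 1 := by rw [map_mul, hvw, hvmain, one_mul]
    rw [hk4, v_add_eq_of_lt (by rw [hm]; exact hvrest), hm]
  have hD₀eq : D₀ = -(D₁ * (σ x * x + w * (σ y * y))) := by rw [hD₀, hD₂]; ring
  have hvD₀ : Valued.v D₀ = (Valued.v ϖ ^ c)⁻¹ := by
    rw [hD₀eq, Valuation.map_neg, map_mul, hvD₁, hvk4, mul_one]
  have hD₀0 : D₀ ≠ 0 := fun h => by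
    rw [h, map_zero] at hvD₀; exact (inv_ne_zero hvϖc) hvD₀.symm
  -- the diagonal form
  let D : Fin 3 → K := ![D₀, D₁, D₂]
  have hD0 : D 0 = D₀ := rfl
  have hD1 : D 1 = D₁ := rfl
  have hD2 : D 2 = D₂ := rfl
  refine ⟨D, ⟨?_, ?_, ?_⟩, fun i => ?_, ?_⟩
  · rw [hD1]
  · rw [hD2, hD₂, hD₁]
  · rw [hD0, hD₀, hD₂, hD₁]
  · fin_cases i
    · exact ⟨hσD₀, hD₀0⟩
    · exact ⟨hσD₁, hD₁0⟩
    · exact ⟨hσD₂, hD₂0⟩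
  -- the Gram matrix and its integrality
  have hG := formCongr_hnf_diagonal σ D x y (ϖ ^ ρ * ζ) (ϖ ^ ρ) (ϖ ^ c) V (by rw [hV])
  rw [hD0, hD1, hD2] at hG
  have hG00 : D₀ + σ x * D₁ * x + σ y * D₂ * y = 0 := by rw [hD₀]; ring
  have hvϖρ : Valued.v (ϖ ^ ρ) = Valued.v ϖ ^ ρ := map_pow _ _ _
  have hvσϖρ : Valued.v (σ (ϖ ^ ρ)) = Valued.v ϖ ^ ρ := by rw [hvσ, map_pow]
  have hvϖcK : Valued.v (ϖ ^ c) = Valued.v ϖ ^ c := map_pow _ _ _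
  have hpowle : ∀ n : ℕ, Valued.v ϖ ^ n ≤ 1 := fun n => pow_le_one₀ zero_le hϖ1'
  have hGint : IsIntMatrix (formCongr σ V (Matrix.diagonal D)) := by
    rw [hG]
    refine isIntMatrix_of_fin_three ?_ ?_ ?_ ?_ ?_ ?_ ?_ ?_ ?_
    · rw [hG00, map_zero]; exact zero_le
    · -- `G₀₁ = ϖ^ρ (D₁σx + D₂ζσy)`
      rw [show σ x * D₁ * ϖ ^ ρ + σ y * D₂ * (ϖ ^ ρ * ζ) = (D₁ * σ x + D₂ * ζ * σ y) * ϖ ^ ρ by ring, map_mul, hvϖρ]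
      exact hvk1
    · rw [map_mul, map_mul, hvσ, hvD₂, hvϖcK, mul_assoc, inv_mul_cancel₀ hvϖc, mul_one]; exact hvy
    · -- `G₁₀ = σ(ϖ^ρ)·σ(D₁σx + D₂ζσy)`
      have e : σ (ϖ ^ ρ) * D₁ * x + σ (ϖ ^ ρ * ζ) * D₂ * y = σ (ϖ ^ ρ) * σ (D₁ * σ x + D₂ * ζ * σ y) := by
        rw [map_add, map_mul, map_mul, map_mul, map_mul, hσ, hσ, hσD₁, hσD₂]; ring
      rw [e, map_mul, hvσϖρ, hvσ, mul_comm]; exact hvk1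
    · exact hvk2
    · rw [map_mul Valued.v (σ (ϖ ^ ρ * ζ) * D₂) (ϖ ^ c), map_mul Valued.v (σ (ϖ ^ ρ * ζ)) D₂, hvσ, map_mul Valued.v (ϖ ^ ρ) ζ, hvϖρ, hζ, mul_one,
        hvD₂, hvϖcK, mul_assoc, inv_mul_cancel₀ hvϖc, mul_one]; exact hpowle ρ
    · rw [map_mul, map_mul, hvσ, hvϖcK, hvD₂, mul_inv_cancel₀ hvϖc, one_mul]; exact hvy
    · rw [map_mul, map_mul, hvσ, hvϖcK, hvD₂, mul_inv_cancel₀ hvϖc, one_mul, map_mul, hvϖρ, hζ, mul_one]; exact hpowle ρ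
    · rw [map_mul, map_mul, hvσ, hvϖcK, hvD₂, mul_inv_cancel₀ hvϖc, one_mul]; exact hpowle c
  -- the determinant
  have hdet : Valued.v (formCongr σ V (Matrix.diagonal D)).det = 1 := by
    rw [det_formCongr_diagonal, det_coe_hnf x y (ϖ ^ ρ * ζ) (ϖ ^ ρ) (ϖ ^ c) V (by rw [hV]), hD0, hD1, hD2]
    simp only [map_mul, map_pow, hvσ, hvD₀, hvD₁, hvD₂]
    set A := Valued.v ϖ ^ ρ with hA
    set C := Valued.v ϖ ^ c with hC
    have hA0 : A ≠ 0 := pow_ne_zero _ hvϖ.ne'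
    have hC0 : C ≠ 0 := hvϖc
    calc A * C * (C⁻¹ * C⁻¹ * C⁻¹) * (A * C) = (A * A * C⁻¹) * (C * C⁻¹) * (C * C⁻¹) := by ac_rfl
      _ = 1 := by
          rw [mul_inv_cancel₀ hC0, mul_one, mul_one, show A * A = C by rw [hA, hC, ← pow_add, hc]; congr 1; ring, mul_inv_cancel₀ hC0]
  have hinv : IsIntMatrix (ϖ • (formCongr σ V (Matrix.diagonal D))⁻¹) := fun i j => by
    rw [Matrix.smul_apply, smul_eq_mul, map_mul]
    exact mul_le_one' hϖ1' (isIntMatrix_nonsing_inv_of_v_det_eq_one hGint hdet i j)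
  exact (isVertexLattice_latt_iff_of_v σ hvσ hϖ0 (Matrix.diagonal D) 0 V).2 ⟨hGint, hinv, by rw [hdet, pow_zero]⟩


/-! ## §2 The ω-table of the polarisation at an exact invariant `y″ = f·xζ` -/

omit [Valued K ℤᵐ⁰] in
/-- `ω` of a norm times `x` is `ω(x)`. [cite: Rogawski1990, §4.10 p. 58] -/
theorem normSign_mul_norm' (σ : K →+* K) (x : K) {z : K} (hz : z ≠ 0) : normSign σ (z * σ z * x) = normSign σ x := by
  rw [show z * σ z * x = x * (z * σ z) by ring]
  exact F0P3cDyRamFixedCountDiagonalModel.normSign_mul_norm σ x hz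

/-- **THE ω-TABLE**: for the §1 polarisation at `y″ = f·(xζ)` with lineariser `f′ = f·ζσζ` (`f` a fixed unit, `|1+f| = 1`): `ω(D 1) = 1`, `ω(D 2) = ω(−(1+f))`, `ω(D 0) = ω(f)`.
[cite: Rogawski1990, §4.10 p. 58] [cite: Kottwitz1986BaseChangeUnits, §1 pp. 240–241] -/
theorem normSign_polarisation_coreHanging (σ : K →+* K) {ϖ : K} (hϖ0 : ϖ ≠ 0) (ρ : ℕ)
    {x ζ f : K} (hx : Valued.v x = 1) (hζ : Valued.v ζ = 1) (hσf : σ f = f) (hf : Valued.v f = 1) (h1f : Valued.v (1 + f) = 1)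
    {D : Fin 3 → K} (hD1 : D 1 = ((ϖ * σ ϖ) ^ ρ)⁻¹) (hD2 : D 2 = -(ζ * σ ζ + f * (ζ * σ ζ))⁻¹ * ((ϖ * σ ϖ) ^ ρ)⁻¹)
    (hD0 : D 0 = -(((ϖ * σ ϖ) ^ ρ)⁻¹ * (σ x * x) + -(ζ * σ ζ + f * (ζ * σ ζ))⁻¹ * ((ϖ * σ ϖ) ^ ρ)⁻¹ * (σ (x * ζ + f * (x * ζ)) * (x * ζ + f * (x * ζ))))) :
    normSign σ (D 1) = 1 ∧ normSign σ (D 2) = normSign σ (-(1 + f)) ∧ normSign σ (D 0) = normSign σ f := by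
  have hx0 : x ≠ 0 := fun h => by rw [h, map_zero] at hx; exact zero_ne_one hx
  have hζ0 : ζ ≠ 0 := fun h => by rw [h, map_zero] at hζ; exact zero_ne_one hζ
  have hf0 : f ≠ 0 := fun h => by rw [h, map_zero] at hf; exact zero_ne_one hf
  have h1f0 : 1 + f ≠ 0 := fun h => by rw [h, map_zero] at h1f; exact zero_ne_one h1f
  have hσx0 : σ x ≠ 0 := (map_ne_zero σ).2 hx0
  have hσζ0 : σ ζ ≠ 0 := (map_ne_zero σ).2 hζ0
  have hσϖ0 : σ ϖ ≠ 0 := (map_ne_zero σ).2 hϖ0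
  have hN0 : ζ * σ ζ ≠ 0 := mul_ne_zero hζ0 hσζ0
  -- the inverse uniformiser power is a norm
  set z : K := (ϖ ^ ρ)⁻¹ with hz
  have hz0 : z ≠ 0 := inv_ne_zero (pow_ne_zero _ hϖ0)
  have hP : ((ϖ * σ ϖ) ^ ρ)⁻¹ = z * σ z := by rw [hz, map_inv₀, map_pow, mul_pow, mul_inv]
  refine ⟨?_, ?_, ?_⟩
  · rw [hD1, hP]
    exact normSign_of_isNorm σ ⟨z, rfl⟩
  · -- `D 2 = (−(1+f))⁻¹ · N((ϖ^ρ ζ)⁻¹)`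
    have hσz0 : σ z ≠ 0 := (map_ne_zero σ).2 hz0
    have e : D 2 = (ζ⁻¹ * z) * σ (ζ⁻¹ * z) * (-(1 + f))⁻¹ := by
      rw [hD2, hP]; simp only [map_mul, map_inv₀]; field_simp
    calc normSign σ (D 2) = normSign σ (-(1 + f))⁻¹ := by rw [e, normSign_mul_norm' σ _ (mul_ne_zero (inv_ne_zero hζ0) hz0)]
      _ = normSign σ (-(1 + f)) :=
          Literature.NumberTheory.Automorphic.UnitaryThreeFourFrame.normSign_inv_of_map_eq σ (by rw [map_neg, map_add, map_one, hσf]) (neg_ne_zero.2 h1f0)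
  · -- `D 0 = f · N(x·(ϖ^ρ)⁻¹)`
    have hy : x * ζ + f * (x * ζ) = x * ζ * (1 + f) := by ring
    have e : D 0 = (x * z) * σ (x * z) * f := by
      rw [hD0, hy, hP, map_mul, map_mul, map_mul, map_add, map_one, hσf]; field_simp; ring
    rw [e, normSign_mul_norm' σ _ (mul_ne_zero hx0 hz0)]

end Summit.HodgeConjecture.HodgeConjecture.Cruxes.H413.F0P3cDyRamDiagonalCoreHangingPolarisationExplicit

end
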